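import Literature.NumberTheory.LFunctions.LargeValuesGuthMaynardReduction
import HarnessLib

/-!
# The majorant principle for double zeta sums

Topic `NumberTheory/LFunctions`, family RH. Heath-Brown's theorem [Heath-Brown 1979, "A large
values estimate for Dirichlet polynomials"; Theorem "Heath-Brown" of Guth–Maynard §6; Lemma 11.5 of
Ivić's book] bounds the *double zeta sums* `∑_{t₁,t₂ ∈ 𝒯} |∑_{n ∼ N} a_n n^{i(t₁−t₂)}|²`, which enter
Guth–Maynard's Propositions 6.1 and 11.1 (the two remaining uses of Heath-Brown's theorem in the
reduction of `zeroDensity_guth_maynard`, see `LargeValuesAssembly.lean`). This file PROVES the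
elementary *majorant principle* for such sums (the device of Ivić's Lemma 11.1, in the form needed by
Guth–Maynard, who apply Heath-Brown's theorem to coefficients `|b_m| ≤ M^{o(1)}`): writing
`R_{n,m} = ∑_{t ∈ 𝒯} n^{it} m^{-it}` (Guth–Maynard's `R(n/m)`, eq. (7.2)),
`∑_{t₁,t₂} |∑_n a_n n^{i(t₁−t₂)}|² = ∑_{n,m} a_n ā_m |R_{n,m}|²` (`double_sum_eq`; the display before
Lemma 11.3 of the paper), hence `∑_{t₁,t₂} |∑_n a_n n^{i(t₁−t₂)}|² ≤ ∑_{t₁,t₂} |∑_n b_n n^{i(t₁−t₂)}|²`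
whenever `|a_n| ≤ b_n` (`double_sum_majorant`), and the sums are nonnegative reals. No definition and
no named fact is introduced.

## References

* A. Ivić, *The Riemann zeta-function*, Wiley 1985 (Dover 2003): §11.5 (Lemma 11.1), §11.6
  (Lemma 11.5, Heath-Brown's estimate) and the Notes to Chapter 11.
* L. Guth, J. Maynard, *New large value estimates for Dirichlet polynomials*, Ann. of Math. (2)
  203 (2026); arXiv:2405.20552: §6 (Theorem "Heath-Brown", (6.3)–(6.4)), §7 eq. (7.2), §11.
* D. R. Heath-Brown, *A large values estimate for Dirichlet polynomials*, J. London Math. Soc. (2)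
  20 (1979), 8–18.
-/

noncomputable section

open Complex Finset

namespace Literature.NumberTheory.LFunctions

namespace DoubleZetaSum

/-- `conj(m^s) = m^{conj s}` for natural `m`. [folklore] -/
theorem conj_natCast_cpow (m : ℕ) (s : ℂ) :
    (starRingEnd ℂ) ((m : ℂ) ^ s) = (m : ℂ) ^ ((starRingEnd ℂ) s) := by
  have h := HuxleyLV.conj_natCast_cpow m (-s)
  simpa using h

/-- `conj(it) = −it` for real `t`. [folklore] -/
theorem conj_ofReal_mul_I (t : ℝ) : (starRingEnd ℂ) ((t : ℂ) * I) = -((t : ℂ) * I) := by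
  rw [map_mul, Complex.conj_ofReal, Complex.conj_I]; ring

/-- `n^{i(t₁−t₂)} conj(m^{i(t₁−t₂)}) = u(t₁) conj(u(t₂))` with `u(t) = n^{it} m^{-it}` (`n, m ≥ 1`).
[folklore] -/
theorem summand_eq {n m : ℕ} (hn : n ≠ 0) (hm : m ≠ 0) (t₁ t₂ : ℝ) :
    (n : ℂ) ^ ((((t₁ - t₂ : ℝ)) : ℂ) * I) * (starRingEnd ℂ) ((m : ℂ) ^ ((((t₁ - t₂ : ℝ)) : ℂ) * I)) =
      ((n : ℂ) ^ ((t₁ : ℂ) * I) * (m : ℂ) ^ (-((t₁ : ℂ) * I))) *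
        (starRingEnd ℂ) ((n : ℂ) ^ ((t₂ : ℂ) * I) * (m : ℂ) ^ (-((t₂ : ℂ) * I))) := by
  have hn0 : (n : ℂ) ≠ 0 := by exact_mod_cast hn
  have hm0 : (m : ℂ) ≠ 0 := by exact_mod_cast hm
  rw [map_mul, conj_natCast_cpow, conj_natCast_cpow, conj_natCast_cpow, map_neg, conj_ofReal_mul_I,
    conj_ofReal_mul_I, neg_neg]
  have e2 : -((((t₁ - t₂ : ℝ)) : ℂ) * I) = (-((t₁ : ℂ) * I)) + (t₂ : ℂ) * I := by push_cast; ring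
  have e1 : (((t₁ - t₂ : ℝ)) : ℂ) * I = (t₁ : ℂ) * I + (-((t₂ : ℂ) * I)) := by push_cast; ring
  rw [e2, e1, Complex.cpow_add _ _ hn0, Complex.cpow_add _ _ hm0]
  ring

/-- Reordering a fourfold finite sum. [folklore] -/
theorem sum_comm₄ {α β : Type*} (s : Finset α) (t : Finset β) (f : α → α → β → β → ℂ) :
    ∑ x₁ ∈ s, ∑ x₂ ∈ s, ∑ y₁ ∈ t, ∑ y₂ ∈ t, f x₁ x₂ y₁ y₂ =
      ∑ y₁ ∈ t, ∑ y₂ ∈ t, ∑ x₁ ∈ s, ∑ x₂ ∈ s, f x₁ x₂ y₁ y₂ := by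
  calc ∑ x₁ ∈ s, ∑ x₂ ∈ s, ∑ y₁ ∈ t, ∑ y₂ ∈ t, f x₁ x₂ y₁ y₂
      = ∑ x₁ ∈ s, ∑ y₁ ∈ t, ∑ x₂ ∈ s, ∑ y₂ ∈ t, f x₁ x₂ y₁ y₂ :=
        Finset.sum_congr rfl fun _ _ ↦ Finset.sum_comm
    _ = ∑ y₁ ∈ t, ∑ x₁ ∈ s, ∑ x₂ ∈ s, ∑ y₂ ∈ t, f x₁ x₂ y₁ y₂ := Finset.sum_comm
    _ = ∑ y₁ ∈ t, ∑ x₁ ∈ s, ∑ y₂ ∈ t, ∑ x₂ ∈ s, f x₁ x₂ y₁ y₂ :=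
        Finset.sum_congr rfl fun _ _ ↦ Finset.sum_congr rfl fun _ _ ↦ Finset.sum_comm
    _ = ∑ y₁ ∈ t, ∑ y₂ ∈ t, ∑ x₁ ∈ s, ∑ x₂ ∈ s, f x₁ x₂ y₁ y₂ :=
        Finset.sum_congr rfl fun _ _ ↦ Finset.sum_comm

/-- **The `R`-function expansion of a double zeta sum**: for `S ⊂ ℕ_{≥1}` and finite `𝒯 ⊂ ℝ`,
`∑_{t₁,t₂∈𝒯} |∑_{n∈S} a_n n^{i(t₁−t₂)}|² = ∑_{n,m∈S} a_n ā_m |∑_{t∈𝒯} n^{it} m^{-it}|²`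
(so the left side is `∑_{n,m} a_n ā_m |R(n/m)|²` with `R(v) = ∑_{t∈𝒯} v^{it}`).
[cite: GuthMaynard2026, Section 11, display before Lemma 11.3] -/
theorem double_sum_eq (𝒯 : Finset ℝ) (S : Finset ℕ) (hS : ∀ n ∈ S, n ≠ 0) (a : ℕ → ℂ) :
    (((∑ t₁ ∈ 𝒯, ∑ t₂ ∈ 𝒯,
      ‖∑ n ∈ S, a n * (n : ℂ) ^ ((((t₁ - t₂ : ℝ)) : ℂ) * I)‖ ^ 2 : ℝ)) : ℂ) =
      ∑ n ∈ S, ∑ m ∈ S, a n * (starRingEnd ℂ) (a m) *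
        (((‖∑ t ∈ 𝒯, (n : ℂ) ^ ((t : ℂ) * I) * (m : ℂ) ^ (-((t : ℂ) * I))‖ ^ 2 : ℝ)) : ℂ) := by
  simp only [Complex.ofReal_sum, Complex.ofReal_pow, ← Complex.mul_conj']
  -- expand the left side
  have hL : ∀ t₁ ∈ 𝒯, ∀ t₂ ∈ 𝒯, (∑ n ∈ S, a n * (n : ℂ) ^ ((((t₁ - t₂ : ℝ)) : ℂ) * I)) *
      (starRingEnd ℂ) (∑ n ∈ S, a n * (n : ℂ) ^ ((((t₁ - t₂ : ℝ)) : ℂ) * I)) =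
      ∑ n ∈ S, ∑ m ∈ S, a n * (starRingEnd ℂ) (a m) *
        (((n : ℂ) ^ ((t₁ : ℂ) * I) * (m : ℂ) ^ (-((t₁ : ℂ) * I))) *
          (starRingEnd ℂ) ((n : ℂ) ^ ((t₂ : ℂ) * I) * (m : ℂ) ^ (-((t₂ : ℂ) * I)))) := by
    intro t₁ _ t₂ _
    rw [map_sum, Finset.sum_mul_sum]
    refine Finset.sum_congr rfl fun n hn ↦ Finset.sum_congr rfl fun m hm ↦ ?_
    rw [map_mul, ← summand_eq (hS n hn) (hS m hm)]
    ring
  -- expand the right side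
  have hR : ∀ n ∈ S, ∀ m ∈ S, a n * (starRingEnd ℂ) (a m) *
      ((∑ t ∈ 𝒯, (n : ℂ) ^ ((t : ℂ) * I) * (m : ℂ) ^ (-((t : ℂ) * I))) *
        (starRingEnd ℂ) (∑ t ∈ 𝒯, (n : ℂ) ^ ((t : ℂ) * I) * (m : ℂ) ^ (-((t : ℂ) * I)))) =
      ∑ t₁ ∈ 𝒯, ∑ t₂ ∈ 𝒯, a n * (starRingEnd ℂ) (a m) *
        (((n : ℂ) ^ ((t₁ : ℂ) * I) * (m : ℂ) ^ (-((t₁ : ℂ) * I))) *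
          (starRingEnd ℂ) ((n : ℂ) ^ ((t₂ : ℂ) * I) * (m : ℂ) ^ (-((t₂ : ℂ) * I)))) := by
    intro n _ m _
    rw [map_sum, Finset.sum_mul_sum, Finset.mul_sum]
    refine Finset.sum_congr rfl fun t₁ _ ↦ ?_
    rw [Finset.mul_sum]
  rw [Finset.sum_congr rfl fun t₁ h₁ ↦ Finset.sum_congr rfl fun t₂ h₂ ↦ hL t₁ h₁ t₂ h₂,
    Finset.sum_congr rfl fun n hn ↦ Finset.sum_congr rfl fun m hm ↦ hR n hn m hm]
  exact sum_comm₄ 𝒯 S fun t₁ t₂ n m ↦ a n * (starRingEnd ℂ) (a m) *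
    (((n : ℂ) ^ ((t₁ : ℂ) * I) * (m : ℂ) ^ (-((t₁ : ℂ) * I))) *
      (starRingEnd ℂ) ((n : ℂ) ^ ((t₂ : ℂ) * I) * (m : ℂ) ^ (-((t₂ : ℂ) * I))))

/-- **The majorant principle for double zeta sums** (the device of Ivić's Lemma 11.1; used by
Guth–Maynard to apply Heath-Brown's theorem to coefficients `|b_m| ≤ M^{o(1)}` in (6.3)–(6.4) and in
§11): if `|a_n| ≤ b_n` on `S ⊂ ℕ_{≥1}` then
`∑_{t₁,t₂∈𝒯} |∑_{n∈S} a_n n^{i(t₁−t₂)}|² ≤ ∑_{t₁,t₂∈𝒯} |∑_{n∈S} b_n n^{i(t₁−t₂)}|²`.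
[cite: GuthMaynard2026, Section 6, (6.3)–(6.4)] -/
theorem double_sum_majorant (𝒯 : Finset ℝ) (S : Finset ℕ) (hS : ∀ n ∈ S, n ≠ 0) (a : ℕ → ℂ)
    (b : ℕ → ℝ) (hab : ∀ n ∈ S, ‖a n‖ ≤ b n) :
    ∑ t₁ ∈ 𝒯, ∑ t₂ ∈ 𝒯, ‖∑ n ∈ S, a n * (n : ℂ) ^ ((((t₁ - t₂ : ℝ)) : ℂ) * I)‖ ^ 2 ≤
      ∑ t₁ ∈ 𝒯, ∑ t₂ ∈ 𝒯, ‖∑ n ∈ S, ((b n : ℝ) : ℂ) * (n : ℂ) ^ ((((t₁ - t₂ : ℝ)) : ℂ) * I)‖ ^ 2 := by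
  set K : ℕ → ℕ → ℝ := fun n m ↦
    ‖∑ t ∈ 𝒯, (n : ℂ) ^ ((t : ℂ) * I) * (m : ℂ) ^ (-((t : ℂ) * I))‖ ^ 2 with hK
  have hK0 : ∀ n m, 0 ≤ K n m := fun n m ↦ by positivity
  have ha := double_sum_eq 𝒯 S hS a
  have hb := double_sum_eq 𝒯 S hS (fun n ↦ ((b n : ℝ) : ℂ))
  -- take real parts
  have ha' : ∑ t₁ ∈ 𝒯, ∑ t₂ ∈ 𝒯, ‖∑ n ∈ S, a n * (n : ℂ) ^ ((((t₁ - t₂ : ℝ)) : ℂ) * I)‖ ^ 2 =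
      ∑ n ∈ S, ∑ m ∈ S, (a n * (starRingEnd ℂ) (a m)).re * K n m := by
    have := congrArg Complex.re ha
    rw [Complex.ofReal_re] at this
    rw [this, Complex.re_sum]
    refine Finset.sum_congr rfl fun n _ ↦ ?_
    rw [Complex.re_sum]
    refine Finset.sum_congr rfl fun m _ ↦ ?_
    rw [Complex.re_mul_ofReal]
  have hb' : ∑ t₁ ∈ 𝒯, ∑ t₂ ∈ 𝒯, ‖∑ n ∈ S, ((b n : ℝ) : ℂ) * (n : ℂ) ^ ((((t₁ - t₂ : ℝ)) : ℂ) * I)‖ ^ 2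
      = ∑ n ∈ S, ∑ m ∈ S, (b n * b m) * K n m := by
    have := congrArg Complex.re hb
    rw [Complex.ofReal_re] at this
    rw [this, Complex.re_sum]
    refine Finset.sum_congr rfl fun n _ ↦ ?_
    rw [Complex.re_sum]
    refine Finset.sum_congr rfl fun m _ ↦ ?_
    rw [Complex.re_mul_ofReal, Complex.conj_ofReal, ← Complex.ofReal_mul, Complex.ofReal_re]
  rw [ha', hb']
  refine Finset.sum_le_sum fun n hn ↦ Finset.sum_le_sum fun m hm ↦ ?_
  have h1 : (a n * (starRingEnd ℂ) (a m)).re ≤ b n * b m := by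
    calc (a n * (starRingEnd ℂ) (a m)).re ≤ ‖a n * (starRingEnd ℂ) (a m)‖ := Complex.re_le_norm _
      _ = ‖a n‖ * ‖a m‖ := by rw [norm_mul, Complex.norm_conj]
      _ ≤ b n * b m := mul_le_mul (hab n hn) (hab m hm) (norm_nonneg _)
          ((norm_nonneg _).trans (hab n hn))
  exact mul_le_mul_of_nonneg_right h1 (hK0 n m)

/-- The double zeta sum is the nonnegative real `∑_{n,m} b_n b_m |R_{n,m}|²` for real nonnegative
coefficients. [cite: GuthMaynard2026, Section 11, display before Lemma 11.3] -/
theorem double_sum_real_eq (𝒯 : Finset ℝ) (S : Finset ℕ) (hS : ∀ n ∈ S, n ≠ 0) (b : ℕ → ℝ) :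
    ∑ t₁ ∈ 𝒯, ∑ t₂ ∈ 𝒯, ‖∑ n ∈ S, ((b n : ℝ) : ℂ) * (n : ℂ) ^ ((((t₁ - t₂ : ℝ)) : ℂ) * I)‖ ^ 2 =
      ∑ n ∈ S, ∑ m ∈ S, (b n * b m) *
        ‖∑ t ∈ 𝒯, (n : ℂ) ^ ((t : ℂ) * I) * (m : ℂ) ^ (-((t : ℂ) * I))‖ ^ 2 := by
  have hb := double_sum_eq 𝒯 S hS (fun n ↦ ((b n : ℝ) : ℂ))
  have := congrArg Complex.re hb
  rw [Complex.ofReal_re] at this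
  rw [this, Complex.re_sum]
  refine Finset.sum_congr rfl fun n _ ↦ ?_
  rw [Complex.re_sum]
  refine Finset.sum_congr rfl fun m _ ↦ ?_
  rw [Complex.re_mul_ofReal, Complex.conj_ofReal, ← Complex.ofReal_mul, Complex.ofReal_re]

end DoubleZetaSum

end Literature.NumberTheory.LFunctions

end
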